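/-
Copyright (c) 2026 the pub-hodgecm-mathlib formalisation cell (harness21).  Prover seat hodgecm-mathlib-R90-C14-p02 (g3) (section S6, dealer R90-C14-plan (g2),
card (G1) «E1-DISCHARGE», R90 bus 2026-09-05T03:03:11Z; census 7afcecd4, rulings (Q1)(Q2) + «PLAN =» 03:09:36Z; FLSUM pin 03:3xZ).  FILE 3b = (U0) DISCHARGED IN
EVERY REGIME, hence (E1) ⟸ (U1).  THEOREMS ONLY (no `def`, no `instance`, no notation, no named-fact hypothesis, no `sorry`); lane `--supports stmt-HodgeConjecture-24833
--as helper` (count-neutral helper).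
-/
import Summits.HodgeConjecture.HodgeConjecture.Theorems.R90S6EllipticIdentityTypeOneLetters      -- ★ FILE 3a (this seat): datum, `r`-torus, exponent letters, tags, slot lemma, `Φ = φ_H`
import Summits.HodgeConjecture.HodgeConjecture.Theorems.R90S6EllipticIdentityTypeOneReduction    -- ★ FILE 1b p865148 (this seat): (E1) ⟸ (U0) ∧ (U1)
import Summits.HodgeConjecture.HodgeConjecture.Theorems.R90S6TreeFixDataFlickerU3Hyp             -- ★ GF1 FILE 0 p864908 (p10): (H.0) currency, (H.1) `V₀(t_ϖ) = φ₁`, (H.3) case tag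
import Literature.NumberTheory.Rogawski1990.UnitOrbitalIntegralInertValueThetaZeroComplete       -- ★ Flicker a₀ θ̄ = 0 COMPLETE: `natCard_fixedPoints_unitaryInt_flickerTorusOne_eq_phiZero` (no `hce`)
import Literature.NumberTheory.Rogawski1990.UnitOrbitalIntegralInertValueExponents               -- ★ `UnitaryGroup.add_sub_two_mul_ne_zero` (`a + c − 2b ≠ 0`)
import HarnessLib

/-!
# R90 · S6 — CARD (G1) «E1-DISCHARGE», FILE 3b: THE UNIT-LEVEL κ-IDENTITY (U0) IN EVERY REGIME (★ Flicker Theorem 15), HENCE (E1) ⟸ (U1)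
# (`Theorems/R90S6EllipticIdentityTypeOneUnitLevel.lean`)

Cell `hodgecm-mathlib`, crux H413 (`stmt-HodgeConjecture-24833`), route of record `HCCMUnconditional`; programme R90-TF, section S6 (base `R90-C14`), seat
R90-C14-p02 (g3); card (G1) «E1-DISCHARGE» (dealer R90-C14-plan (g2), 03:03:11Z; «(U0)-deep = FLSUM» 03:09:36Z; pin: ★ `Flicker1998.flicker_theorem15`).
Target of record = typ1 (g3)'s (E1) `delta_mul_kappaSum_ncard_displaced_flicker_eq_sum_xiHCoeff_mul_ncard_displaced_two` (sheet v2.3 `4c174fca74d7a58a` :191).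

THE MATHEMATICS.  With `N = ord(a−c)`, `N₁ = ord(a−b)`, `N₂ = ord(c−b)` (the two smallest agree, ★ FILE 3a `flickerSum_two_smallest_eq`) the hyperspecial fixed-coset
counts of Flicker's four literals are `V₀(t₁) = φ₀(q; N₁, N₂, N)` (★ Flicker a₀ θ̄ = 0, COMPLETE edition — the case-(e) count is PROVED there), `V₀(t_ϖ(a,b,c)) = φ₁(q; N₁, N)`,
`V₀(t_ϖ(a,c,b)) = φ₁(q; N, N₁)`, `V₀(t_ϖ(b,a,c)) = φ₁(q; N₁, N₂)` (★ FILE 0 (H.1) read through (H.3) + the slot lemma), so `Σ±V₀ᵢ = φ_κ(q; N₁, N₂, N) = (−q)^{N₁+N₂}·φ_H(q, N)`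
by ★ FLICKER THEOREM 15; and `Δ = (−q)^{log|(b−a)(b−c)|} = ((−q)^{N₁+N₂})⁻¹`, `Φ = #Fix(δ₁) = #Ball(x₀, N) = φ_H(q, N)` (★ FILE 3a).  Hence **(U0) `Δ·Σ±V₀ᵢ = Φ` in EVERY
depth regime**, under typ1's (E1) v2.3 letters (the ★ a₀ frame + `hfin₀ᵢ` + `x₀ hx₀ hloc hreg`); the letters FILE 0 needs beyond v2.3 (`LocalConjDatum`, the `r`-torus, `1 < q`,
`Nat.card 𝓀 = q²`, `Fintype`) are BUILT (★ FILE 3a, ruling (Q2)).  With ★ FILE 1b: **(E1) for every `m` ⟸ (U1) alone**.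
* §1 `flickerLiteral_mem_centralizer_diag` (the literals commute with `cW = diag(1,−1,1)`); §2 **`delta_mul_kappaSum_natCard_fixedBy_flicker_eq_ncard_fixed`** = (U0);
* §3 HEAD **`delta_mul_kappaSum_ncard_displaced_flicker_eq_sum_xiHCoeff_mul_ncard_displaced_two_of_unitLevelOne`**: (E1)'s conclusion BYTES VERBATIM for every `m` from
  (U1) `Δ·(V₁₁ + V₁₂ − V₁₃ − V₁₄) = Φ − 2` ALONE, under (E1) v2.3's letters (minus `hσe` and `horbᵢ`, unused).
HONEST LABEL: (U0) = the unit fundamental lemma in tree-count letters, now ★ in every regime by re-currencying ★ Flicker a₀ + ★ Theorem 15 (count-neutral); (U1) = its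
special-level twin stays OPEN in the deep regimes (V₁ columns: ★ R2M F1 + p05 F2∕F3, p10 2b; R-III ★ FILE 2).  HC_CM is proved only modulo the 7 printed citations (2 remaining
named inputs: hLiu418 = stmt-HodgeConjecture-24832, h413 = stmt-HodgeConjecture-24833) until rung 0 closes; REL ≠ ★ ≠ BUILT.

## References
* [Flicker1998UnitaryFL] Y. Z. Flicker, *Elementary proof of the fundamental lemma for a unitary group*, Canad. J. Math. 50 (1998): §2 Prop. 3 pp. 78–79, Prop. 5 p. 82,
  Prop. 11 p. 87, Prop. 13 pp. 91–93, Prop. 14 p. 94, §6 Theorem 15 pp. 95–96.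
* [Rogawski1990] J. D. Rogawski, *Automorphic Representations of Unitary Groups in Three Variables*, Ann. of Math. Stud. 123 (1990): §4.9 Prop. 4.9.1 (b) pp. 54–55.
* [Kottwitz1986BaseChangeUnits] R. E. Kottwitz, *Base change for unit elements of Hecke algebras*, Compositio Math. 60 (1986), §3.
* [LabesseLanglands1979] J.-P. Labesse, R. P. Langlands, *L-indistinguishability for SL(2)*, Canad. J. Math. 31 (1979), §§2–3.
-/

set_option autoImplicit false
-- the mandated namespace repeats the single-problem summit's segment (`HodgeConjecture.HodgeConjecture`)
set_option linter.dupNamespace false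

noncomputable section

open MulAction SimpleGraph Finset
open scoped Valued WithZero Matrix MatrixGroups
open Literature.NumberTheory.Automorphic Literature.NumberTheory.Automorphic.HermitianLattice Literature.NumberTheory.Automorphic.UnitaryGroup
open Literature.NumberTheory.Rogawski1990.Flicker1998 (phiZero phiOne phiH phiKappa flicker_theorem15)
open Literature.Combinatorics.SimpleGraph

namespace Summit.HodgeConjecture.HodgeConjecture.R90.S6

section UnitLevel

/-! ## §1 The literals commute with `cW = diag(1, −1, 1)` -/

/-- A `{0,2} ⊔ {1}`-block matrix `!![p, 0, m; 0, s, 0; n, 0, p]` in `U₃` commutes with `cW = diag(1, −1, 1)` (the letter `htH` of the ★ a₀ heads; ★ FILE 0's private twin).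
[cite: Flicker1998UnitaryFL, §3 p. 80] -/
theorem flickerLiteral_mem_centralizer_diag {K : Type} [Field K] {σ : K →+* K}
    {cW γ : ↥(unitaryGroupOfForm σ ((StdForm.antidiagonal 3).over K))}
    (hcW : ((cW : GL (Fin 3) K) : Matrix (Fin 3) (Fin 3) K) = !![1, 0, 0; 0, -1, 0; 0, 0, 1]) {p s m n : K}
    (hγ : ((γ : GL (Fin 3) K) : Matrix (Fin 3) (Fin 3) K) = !![p, 0, m; 0, s, 0; n, 0, p]) :
    γ ∈ Subgroup.centralizer ({cW} : Set ↥(unitaryGroupOfForm σ ((StdForm.antidiagonal 3).over K))) := by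
  rw [Subgroup.mem_centralizer_iff]
  intro h hh
  rw [Set.mem_singleton_iff] at hh
  subst hh
  apply Subtype.ext
  apply Units.ext
  rw [Subgroup.coe_mul, Subgroup.coe_mul, Units.val_mul, Units.val_mul, hcW, hγ]
  ext i j
  fin_cases i <;> fin_cases j <;> simp [Matrix.mul_apply, Fin.sum_univ_three]

/-! ## §2 (U0): `Δ·(V₀₁ + V₀₂ − V₀₃ − V₀₄) = Φ` in every regime -/

-- the ★ a₀ heads' `H`-actions on `H ⧸ (K^{u_m} ∩ H)` and the four `Fintype ↥(fixedBy …)` instances exceed the default synthesis budget (same bump as ★ FILE 0 (H.1)(H.2))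
set_option synthInstance.maxHeartbeats 400000 in
set_option maxHeartbeats 1600000 in
/-- **(U0) — THE UNIT FUNDAMENTAL LEMMA IN TREE-COUNT LETTERS, EVERY DEPTH REGIME.**  Under typ1's (E1) v2.3 letters — the cell's unramified datum with the residual letters,
`|2| = 1`, `2e = 1`, pairwise distinct norm-one `a, b, c`, Flicker's literals `γ₁…γ₄`, the compression `δ₁`, the ★ a₀ frame (completeness, `y, cW, um, (R, ι, σR, dR, ϖR), hqR,
a₀`), the hyperspecial coset-finiteness letters `hfin₀ᵢ`, the `X₂` root ∕ regularity `x₀ hx₀ hloc hreg`: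
`(−q)^{log|(b−a)(b−c)|} · (V₀₁ + V₀₂ − V₀₃ − V₀₄) = #Fix_{X₂}(δ₁)`, `V₀ᵢ = #Fix_{γᵢ}(U₃ ⧸ K₀)`.  Proof: §THE MATHEMATICS (★ Flicker a₀ ∘ ★ Theorem 15 ∘ ★ FILE 3a).
[cite: Flicker1998UnitaryFL, §6 Theorem 15 pp. 95–96; Prop. 11 p. 87; Prop. 14 p. 94] [cite: Rogawski1990, §4.9 Prop. 4.9.1 (b) pp. 54–55] [cite: Kottwitz1986BaseChangeUnits, §3] -/
theorem delta_mul_kappaSum_natCard_fixedBy_flicker_eq_ncard_fixed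
    {K : Type} [Field K] [Valued K ℤᵐ⁰] [ValuativeRel K] [(Valued.v : Valuation K ℤᵐ⁰).Compatible]
    {σ : K →+* K} {ϖ : K} (hd : HermitianLattice.UnramifiedLocalConjDatum σ ϖ)
    (hσO : ∀ x : 𝒪[K], σ x ∈ 𝒪[K]) [Fintype 𝓀[K]] {q : ℕ} (hq : Fintype.card 𝓀[K] = q ^ 2)
    (h2 : Valued.v (2 : K) = 1) {e : K} (h2e : 2 * e = 1)
    {a b c : K} (ha : σ a * a = 1) (hb : σ b * b = 1) (hc : σ c * c = 1) (hab : a ≠ b) (hbc : b ≠ c) (hac : a ≠ c)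
    -- Flicker's four classes of the stable class of the `E¹`-type element with eigenvalues `(a, b, c)`, `b` on the `U(1)`-slot; κ-signs `(+,+,−,−)`
    (γ₁ γ₂ γ₃ γ₄ : unitaryGroupOfForm σ ((StdForm.antidiagonal 3).over K))
    (hγ₁ : ((γ₁ : GL (Fin 3) K) : Matrix (Fin 3) (Fin 3) K) = !![e * (a + c), 0, -(e * (a - c)); 0, b, 0; -(e * (a - c)), 0, e * (a + c)])
    (hγ₂ : ((γ₂ : GL (Fin 3) K) : Matrix (Fin 3) (Fin 3) K) = !![e * (a + c), 0, -(e * (a - c) * ϖ); 0, b, 0; -(e * (a - c) * ϖ⁻¹), 0, e * (a + c)])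
    (hγ₃ : ((γ₃ : GL (Fin 3) K) : Matrix (Fin 3) (Fin 3) K) = !![e * (a + b), 0, -(e * (a - b) * ϖ); 0, c, 0; -(e * (a - b) * ϖ⁻¹), 0, e * (a + b)])
    (hγ₄ : ((γ₄ : GL (Fin 3) K) : Matrix (Fin 3) (Fin 3) K) = !![e * (b + c), 0, -(e * (b - c) * ϖ); 0, a, 0; -(e * (b - c) * ϖ⁻¹), 0, e * (b + c)])
    -- the `U(1,1)`-part of `γ_H`: `δ_1`
    (δ₁ : unitaryGroupOfForm σ ((StdForm.antidiagonal 2).over K))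
    (hδ₁ : ((δ₁ : GL (Fin 2) K) : Matrix (Fin 2) (Fin 2) K) = !![e * (a + c), -(e * (a - c)); -(e * (a - c)), e * (a + c)])
    -- the ★ a₀ frame of typ1's (E1) v2.3 (completeness + FILE 0 (H.1)'s letters VERBATIM)
    [IsDiscreteValuationRing 𝒪[K]] [IsAdicComplete (IsLocalRing.maximalIdeal 𝒪[K]) 𝒪[K]]
    {y : K} (hy : y * σ y = -2)
    {cW : ↥(unitaryGroupOfForm σ ((StdForm.antidiagonal 3).over K))} (hcW : ((cW : GL (Fin 3) K) : Matrix (Fin 3) (Fin 3) K) = !![1, 0, 0; 0, -1, 0; 0, 0, 1])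
    (um : ℕ → ↥(unitaryGroupOfForm σ ((StdForm.antidiagonal 3).over K)))
    (hum : ∀ m, ((um m : GL (Fin 3) K) : Matrix (Fin 3) (Fin 3) K) = !![ϖ ^ m, y, (ϖ ^ m)⁻¹; 0, 1, -σ y * (ϖ ^ m)⁻¹; 0, 0, (ϖ ^ m)⁻¹])
    {R : Type} [CommRing R] [IsDomain R] [IsDiscreteValuationRing R] [Finite (IsLocalRing.ResidueField R)] [IsAdicComplete (IsLocalRing.maximalIdeal R) R]
    (ι : R →+* K) (hι : Function.Injective ι)
    (hιv : ∀ x : K, Valued.v x ≤ 1 ↔ x ∈ Set.range ι) (σR : R →+* R) (hσR : ∀ r, σR (σR r) = r) (hσι : ∀ r, ι (σR r) = σ (ι r))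
    {dR : R} (hdRσ : σR dR = -dR) (hdRu : IsUnit dR) (h2R : IsUnit (2 : R)) {ϖR : R} (hϖR : Irreducible ϖR) (hιϖ : ι ϖR = ϖ)
    (hqR : Nat.card (IsLocalRing.ResidueField R) = q ^ 2)
    {a₀ : 𝒪[K]} (ha₀ : IsUnit (((σ.comp 𝒪[K].subtype).codRestrict 𝒪[K] hσO) a₀ - a₀))
    -- the hyperspecial coset-finiteness letters and the `X₂` root ∕ regularity
    (hfin₀₁ : (fixedBy (↥(unitaryGroupOfForm σ ((StdForm.antidiagonal 3).over K)) ⧸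
      (glInt 3 K).subgroupOf (unitaryGroupOfForm σ ((StdForm.antidiagonal 3).over K))) γ₁).Finite)
    (hfin₀₂ : (fixedBy (↥(unitaryGroupOfForm σ ((StdForm.antidiagonal 3).over K)) ⧸
      (glInt 3 K).subgroupOf (unitaryGroupOfForm σ ((StdForm.antidiagonal 3).over K))) γ₂).Finite)
    (hfin₀₃ : (fixedBy (↥(unitaryGroupOfForm σ ((StdForm.antidiagonal 3).over K)) ⧸
      (glInt 3 K).subgroupOf (unitaryGroupOfForm σ ((StdForm.antidiagonal 3).over K))) γ₃).Finite)
    (hfin₀₄ : (fixedBy (↥(unitaryGroupOfForm σ ((StdForm.antidiagonal 3).over K)) ⧸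
      (glInt 3 K).subgroupOf (unitaryGroupOfForm σ ((StdForm.antidiagonal 3).over K))) γ₄).Finite)
    (x₀ : {M : Submodule (ValuativeRel.valuation K).integer (Fin 2 → K) // HermitianLatticeTree.IsSpecialLattice σ ϖ ((StdForm.antidiagonal 2).over K) M})
    (hx₀ : x₀.1 = HermitianLatticeTree.latt (1 : Matrix (Fin 2) (Fin 2) K))
    (hloc : ∀ v, ((HermitianLatticeTree.latticeTree σ ϖ ((StdForm.antidiagonal 2).over K)).neighborSet v).Finite)
    (hreg : ∀ v, ((HermitianLatticeTree.latticeTree σ ϖ ((StdForm.antidiagonal 2).over K)).neighborSet v).ncard = q + 1) :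
    (-(q : ℂ)) ^ WithZero.log (Valued.v ((b - a) * (b - c))) *
        ((Nat.card (fixedBy (↥(unitaryGroupOfForm σ ((StdForm.antidiagonal 3).over K)) ⧸
            (glInt 3 K).subgroupOf (unitaryGroupOfForm σ ((StdForm.antidiagonal 3).over K))) γ₁) : ℂ) +
          (Nat.card (fixedBy (↥(unitaryGroupOfForm σ ((StdForm.antidiagonal 3).over K)) ⧸
            (glInt 3 K).subgroupOf (unitaryGroupOfForm σ ((StdForm.antidiagonal 3).over K))) γ₂) : ℂ) -
          (Nat.card (fixedBy (↥(unitaryGroupOfForm σ ((StdForm.antidiagonal 3).over K)) ⧸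
            (glInt 3 K).subgroupOf (unitaryGroupOfForm σ ((StdForm.antidiagonal 3).over K))) γ₃) : ℂ) -
          (Nat.card (fixedBy (↥(unitaryGroupOfForm σ ((StdForm.antidiagonal 3).over K)) ⧸
            (glInt 3 K).subgroupOf (unitaryGroupOfForm σ ((StdForm.antidiagonal 3).over K))) γ₄) : ℂ)) =
      (({v | HermitianLatticeTree.latticeTreeIso σ ϖ ((StdForm.antidiagonal 2).over K) δ₁ v = v}.ncard : ℕ) : ℂ) := by
  classical
  -- the letters FILE 0 needs beyond v2.3 (ruling (Q2)): datum, `r`-torus, `1 < q`, `Nat.card 𝓀 = q²`, `Fintype`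
  have hd' : LocalConjDatum σ ϖ := localConjDatum_of_isAdicComplete hd h2
  have hq1 : 1 < q := by
    have h : 1 < q ^ 2 := hq ▸ Fintype.one_lt_card
    exact (Nat.pow_lt_pow_iff_left two_ne_zero).1 (by rwa [one_pow])
  have hqN : Nat.card (IsLocalRing.ResidueField 𝒪[K]) = q ^ 2 := natCard_residueField_eq_of_card hq
  obtain ⟨r, hr⟩ := exists_centralizer_coe_eq_diag_zpow hd hcW
  haveI := hfin₀₁.fintype
  haveI := hfin₀₂.fintype
  haveI := hfin₀₃.fintype
  haveI := hfin₀₄.fintype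
  have hϖpos : 0 < Valued.v ϖ := by rw [hd.vϖ]; exact WithZero.exp_pos
  have hϖ1 : Valued.v ϖ < 1 := by rw [hd.vϖ, ← WithZero.exp_zero]; exact WithZero.exp_lt_exp.2 (by norm_num)
  have h20 : (2 : K) ≠ 0 := fun h => by rw [h, map_zero] at h2; exact zero_ne_one h2
  -- the norm-one letters are units
  have hva : Valued.v a = 1 := (flickerLiteral_norm_one_letters σ hd.vσ ha).2
  have hvb : Valued.v b = 1 := (flickerLiteral_norm_one_letters σ hd.vσ hb).2
  have hvc : Valued.v c = 1 := (flickerLiteral_norm_one_letters σ hd.vσ hc).2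
  have hv2 : ∀ x : K, Valued.v x = 1 → Valued.v (2 * x) ≤ 1 := fun x hx => by rw [map_mul, h2, hx, one_mul]
  have hsub : ∀ x y : K, Valued.v x = 1 → Valued.v y = 1 → Valued.v (x - y) ≤ 1 := fun x y hx hy =>
    (Valuation.map_sub _ _ _).trans (max_le hx.le hy.le)
  have hadd3 : ∀ x y z : K, Valued.v x = 1 → Valued.v y = 1 → Valued.v z = 1 → Valued.v (x + y - 2 * z) ≤ 1 := fun x y z hx hy hz =>
    (Valuation.map_sub _ _ _).trans (max_le ((Valuation.map_add _ _ _).trans (max_le hx.le hy.le)) (hv2 z hz))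
  -- the exponent letters
  obtain ⟨N, hN⟩ := exists_v_eq_v_pow_of_datum hd (sub_ne_zero.2 hac) (hsub a c hva hvc)
  obtain ⟨N₁, hN₁⟩ := exists_v_eq_v_pow_of_datum hd (sub_ne_zero.2 hab) (hsub a b hva hvb)
  obtain ⟨N₂, hN₂⟩ := exists_v_eq_v_pow_of_datum hd (sub_ne_zero.2 hbc.symm) (hsub c b hvc hvb)
  obtain ⟨Np, hNp⟩ := exists_v_eq_v_pow_of_datum hd (UnitaryGroup.add_sub_two_mul_ne_zero σ h20 ha hb hc hac) (hadd3 a c b hva hvc hvb)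
  obtain ⟨Np', hNp'⟩ := exists_v_eq_v_pow_of_datum hd (UnitaryGroup.add_sub_two_mul_ne_zero σ h20 ha hc hb hab) (hadd3 a b c hva hvb hvc)
  obtain ⟨Np'', hNp''⟩ := exists_v_eq_v_pow_of_datum hd (UnitaryGroup.add_sub_two_mul_ne_zero σ h20 hb ha hc hbc) (hadd3 b c a hvb hvc hva)
  have hN₁' : Valued.v (b - a) = Valued.v (ϖ ^ N₁) := by rw [Valuation.map_sub_swap]; exact hN₁
  have hN₂' : Valued.v (b - c) = Valued.v (ϖ ^ N₂) := by rw [Valuation.map_sub_swap]; exact hN₂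
  have hN' : Valued.v (c - a) = Valued.v (ϖ ^ N) := by rw [Valuation.map_sub_swap]; exact hN
  -- ★ FILE 0 (H.1): the three `θ̄ = 1` literals
  have hV₂ := flickerFix_natCard_fixedBy_hyp_tpi hd' hσO hy hcW um hum ι hι hιv σR hσR hσι hdRσ hdRu h2R hϖR hιϖ r hr hqN hqR hq1 ha₀
    h2e ha hb hc γ₂ hγ₂ hN hNp
  have hV₃ := flickerFix_natCard_fixedBy_hyp_tpi hd' hσO hy hcW um hum ι hι hιv σR hσR hσι hdRσ hdRu h2R hϖR hιϖ r hr hqN hqR hq1 ha₀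
    h2e ha hc hb γ₃ hγ₃ hN₁ hNp'
  have hV₄ := flickerFix_natCard_fixedBy_hyp_tpi hd' hσO hy hcW um hum ι hι hιv σR hσR hσι hdRσ hdRu h2R hϖR hιϖ r hr hqN hqR hq1 ha₀
    h2e hb ha hc γ₄ hγ₄ hN₂' hNp''
  -- ★ Flicker a₀ θ̄ = 0 (COMPLETE edition, case (e) proved there), read in GF1's coset currency as in ★ FILE 0 (H.2)
  have hV₁ : (Nat.card (fixedBy (↥(unitaryGroupOfForm σ ((StdForm.antidiagonal 3).over K)) ⧸
      (glInt 3 K).subgroupOf (unitaryGroupOfForm σ ((StdForm.antidiagonal 3).over K))) γ₁) : ℚ) = phiZero q N₁ N₂ N := by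
    have htH := flickerLiteral_mem_centralizer_diag hcW hγ₁
    have hfin : (fixedBy (↥(unitaryGroupOfForm σ ((StdForm.antidiagonal 3).over K)) ⧸
        (glInt 3 K).subgroupOf (unitaryGroupOfForm σ ((StdForm.antidiagonal 3).over K))) γ₁).Finite := Set.toFinite _
    have hK : (glInt 3 K).subgroupOf (unitaryGroupOfForm σ ((StdForm.antidiagonal 3).over K)) = unitaryInt σ ((StdForm.antidiagonal 3).over K) := by
      ext g
      rw [Subgroup.mem_subgroupOf, mem_glInt_iff_isIntMatrix, mem_unitaryInt_iff]
      rfl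
    have htag := flickerFix_thetaZero_caseTag hϖpos hϖ1 h2 hN hNp hN₁ hN₂
    rw [hK] at hfin ⊢
    exact natCard_fixedPoints_unitaryInt_flickerTorusOne_eq_phiZero σ rfl hd' hσO hy hcW um hum ι hι hιv σR hσR hσι hdRσ hdRu h2R hϖR hιϖ
      hqR hqN ha₀ h2e ha hb hc hγ₁ htH r hr hN hNp hN₁ hN₂ htag hfin
  -- the slot lemma on the three `φ₁`'s (★ FILE 0 (H.3) case tags for the permuted letters)
  have hs₂ : phiOne q Np N = phiOne q N₁ N := phiOne_eq_of_caseTag q (flickerFix_thetaZero_caseTag hϖpos hϖ1 h2 hN hNp hN₁ hN₂)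
  have hs₃ : phiOne q Np' N₁ = phiOne q N N₁ := phiOne_eq_of_caseTag q (flickerFix_thetaZero_caseTag hϖpos hϖ1 h2 hN₁ hNp' hN hN₂')
  have hs₄ : phiOne q Np'' N₂ = phiOne q N₁ N₂ := phiOne_eq_of_caseTag q (flickerFix_thetaZero_caseTag hϖpos hϖ1 h2 hN₂' hNp'' hN₁' hN')
  -- ★ FLICKER THEOREM 15 and `Φ = φ_H`
  have h15 := flicker_theorem15 hq1 (flickerSum_two_smallest_eq hϖpos hϖ1 hN hN₁ hN₂)
  have hΦ := ncard_compression_fixed_eq_phiH hd h2 h2e ha hc hN δ₁ hδ₁ x₀ hx₀ hloc hq1 hreg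
  have key : ((Nat.card (fixedBy (↥(unitaryGroupOfForm σ ((StdForm.antidiagonal 3).over K)) ⧸
        (glInt 3 K).subgroupOf (unitaryGroupOfForm σ ((StdForm.antidiagonal 3).over K))) γ₁) : ℚ) +
      (Nat.card (fixedBy (↥(unitaryGroupOfForm σ ((StdForm.antidiagonal 3).over K)) ⧸
        (glInt 3 K).subgroupOf (unitaryGroupOfForm σ ((StdForm.antidiagonal 3).over K))) γ₂) : ℚ) -
      (Nat.card (fixedBy (↥(unitaryGroupOfForm σ ((StdForm.antidiagonal 3).over K)) ⧸
        (glInt 3 K).subgroupOf (unitaryGroupOfForm σ ((StdForm.antidiagonal 3).over K))) γ₃) : ℚ) -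
      (Nat.card (fixedBy (↥(unitaryGroupOfForm σ ((StdForm.antidiagonal 3).over K)) ⧸
        (glInt 3 K).subgroupOf (unitaryGroupOfForm σ ((StdForm.antidiagonal 3).over K))) γ₄) : ℚ)) =
      (-(q : ℚ)) ^ (N₁ + N₂) * (({v | HermitianLatticeTree.latticeTreeIso σ ϖ ((StdForm.antidiagonal 2).over K) δ₁ v = v}.ncard : ℕ) : ℚ) := by
    rw [hV₁, hV₂, hV₃, hV₄, hs₂, hs₃, hs₄, hΦ, ← h15, phiKappa]
  have keyC := congrArg (fun x : ℚ => (x : ℂ)) key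
  push_cast at keyC
  -- `Δ = ((−q)^{N₁+N₂})⁻¹`
  have hΔ : (-(q : ℂ)) ^ WithZero.log (Valued.v ((b - a) * (b - c))) = ((-(q : ℂ)) ^ (N₁ + N₂))⁻¹ := by
    rw [map_mul, hN₁', hN₂', map_pow, map_pow, hd.vϖ, ← WithZero.exp_nsmul, ← WithZero.exp_nsmul, ← WithZero.exp_add, WithZero.log_exp,
      nsmul_eq_mul, nsmul_eq_mul, mul_neg_one, mul_neg_one, ← neg_add, ← Nat.cast_add, zpow_neg, zpow_natCast]
  have hq0 : (-(q : ℂ)) ^ (N₁ + N₂) ≠ 0 := pow_ne_zero _ (neg_ne_zero.2 (by exact_mod_cast (by omega : q ≠ 0)))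
  rw [hΔ, keyC, inv_mul_cancel_left₀ hq0]

/-! ## §3 HEAD: (E1) for every `m` from (U1) alone -/

-- as above (the ★ a₀ heads and the `Fintype` instances inside)
set_option synthInstance.maxHeartbeats 400000 in
set_option maxHeartbeats 1600000 in
/-- **(E1) ⟸ (U1) — THE TYPE-(1) ELLIPTIC κ-IDENTITY AT EVERY DISPLACEMENT `m` FROM THE SPECIAL-LEVEL UNIT IDENTITY ALONE.**  Under typ1's (E1) v2.3 letters
(`4c174fca74d7a58a` :191 — all of them except the unused `hσe` and `horbᵢ`), the hypothesis (U1) `(−q)^{log|(b−a)(b−c)|}·(V₁₁ + V₁₂ − V₁₃ − V₁₄) = #Fix_{X₂}(δ₁) − 2`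
(`V₁ᵢ = #Fix_{γᵢ}(U₃ ⧸ K₁)`, the special fixed vertices) gives (E1)'s conclusion (BYTES VERBATIM) — ★ FILE 1b `…_of_unitLevels` at (U0) = §2 and (U1).
[cite: Rogawski1990, §4.9 Prop. 4.9.1 (b) pp. 54–55] [cite: Flicker1998UnitaryFL, §2 Prop. 3 pp. 78–79; §6 Theorem 15 pp. 95–96] [cite: LabesseLanglands1979, §§2–3] -/
theorem delta_mul_kappaSum_ncard_displaced_flicker_eq_sum_xiHCoeff_mul_ncard_displaced_two_of_unitLevelOne
    {K : Type} [Field K] [Valued K ℤᵐ⁰] [ValuativeRel K] [(Valued.v : Valuation K ℤᵐ⁰).Compatible]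
    {σ : K →+* K} {ϖ : K} (hd : HermitianLattice.UnramifiedLocalConjDatum σ ϖ)
    (hσO : ∀ x : 𝒪[K], σ x ∈ 𝒪[K]) (σk : 𝓀[K] →+* 𝓀[K])
    (hσk : ∀ x : 𝒪[K], IsLocalRing.residue 𝒪[K] ⟨σ x, hσO x⟩ = σk (IsLocalRing.residue 𝒪[K] x))
    [Fintype 𝓀[K]] {q : ℕ} (hq : Fintype.card 𝓀[K] = q ^ 2) (hfrob : ∀ y, σk y = y ^ q)
    (h2 : Valued.v (2 : K) = 1) {e : K} (h2e : 2 * e = 1)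
    {a b c : K} (ha : σ a * a = 1) (hb : σ b * b = 1) (hc : σ c * c = 1) (hab : a ≠ b) (hbc : b ≠ c) (hac : a ≠ c)
    -- Flicker's four classes of the stable class of the `E¹`-type element with eigenvalues `(a, b, c)`, `b` on the `U(1)`-slot; κ-signs `(+,+,−,−)`
    (γ₁ γ₂ γ₃ γ₄ : unitaryGroupOfForm σ ((StdForm.antidiagonal 3).over K))
    (hγ₁ : ((γ₁ : GL (Fin 3) K) : Matrix (Fin 3) (Fin 3) K) = !![e * (a + c), 0, -(e * (a - c)); 0, b, 0; -(e * (a - c)), 0, e * (a + c)])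
    (hγ₂ : ((γ₂ : GL (Fin 3) K) : Matrix (Fin 3) (Fin 3) K) = !![e * (a + c), 0, -(e * (a - c) * ϖ); 0, b, 0; -(e * (a - c) * ϖ⁻¹), 0, e * (a + c)])
    (hγ₃ : ((γ₃ : GL (Fin 3) K) : Matrix (Fin 3) (Fin 3) K) = !![e * (a + b), 0, -(e * (a - b) * ϖ); 0, c, 0; -(e * (a - b) * ϖ⁻¹), 0, e * (a + b)])
    (hγ₄ : ((γ₄ : GL (Fin 3) K) : Matrix (Fin 3) (Fin 3) K) = !![e * (b + c), 0, -(e * (b - c) * ϖ); 0, a, 0; -(e * (b - c) * ϖ⁻¹), 0, e * (b + c)])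
    -- the two classes of the stable class of the `U(1,1)`-part of `γ_H = (δ, b)`: `δ_1`, `δ_ϖ`
    (δ₁ δ₂ : unitaryGroupOfForm σ ((StdForm.antidiagonal 2).over K))
    (hδ₁ : ((δ₁ : GL (Fin 2) K) : Matrix (Fin 2) (Fin 2) K) = !![e * (a + c), -(e * (a - c)); -(e * (a - c)), e * (a + c)])
    (hδ₂ : ((δ₂ : GL (Fin 2) K) : Matrix (Fin 2) (Fin 2) K) = !![e * (a + c), -(e * (a - c) * ϖ); -(e * (a - c) * ϖ⁻¹), e * (a + c)])
    -- the ★ a₀ frame of typ1's (E1) v2.3 (completeness + FILE 0 (H.1)'s letters VERBATIM)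
    [IsDiscreteValuationRing 𝒪[K]] [IsAdicComplete (IsLocalRing.maximalIdeal 𝒪[K]) 𝒪[K]]
    {y : K} (hy : y * σ y = -2)
    {cW : ↥(unitaryGroupOfForm σ ((StdForm.antidiagonal 3).over K))} (hcW : ((cW : GL (Fin 3) K) : Matrix (Fin 3) (Fin 3) K) = !![1, 0, 0; 0, -1, 0; 0, 0, 1])
    (um : ℕ → ↥(unitaryGroupOfForm σ ((StdForm.antidiagonal 3).over K)))
    (hum : ∀ m, ((um m : GL (Fin 3) K) : Matrix (Fin 3) (Fin 3) K) = !![ϖ ^ m, y, (ϖ ^ m)⁻¹; 0, 1, -σ y * (ϖ ^ m)⁻¹; 0, 0, (ϖ ^ m)⁻¹])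
    {R : Type} [CommRing R] [IsDomain R] [IsDiscreteValuationRing R] [Finite (IsLocalRing.ResidueField R)] [IsAdicComplete (IsLocalRing.maximalIdeal R) R]
    (ι : R →+* K) (hι : Function.Injective ι)
    (hιv : ∀ x : K, Valued.v x ≤ 1 ↔ x ∈ Set.range ι) (σR : R →+* R) (hσR : ∀ r, σR (σR r) = r) (hσι : ∀ r, ι (σR r) = σ (ι r))
    {dR : R} (hdRσ : σR dR = -dR) (hdRu : IsUnit dR) (h2R : IsUnit (2 : R)) {ϖR : R} (hϖR : Irreducible ϖR) (hιϖ : ι ϖR = ϖ)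
    (hqR : Nat.card (IsLocalRing.ResidueField R) = q ^ 2)
    {a₀ : 𝒪[K]} (ha₀ : IsUnit (((σ.comp 𝒪[K].subtype).codRestrict 𝒪[K] hσO) a₀ - a₀))
    (g₁ : GL (Fin 3) K) (hg₁ : (g₁ : Matrix (Fin 3) (Fin 3) K) = Matrix.diagonal ![(1 : K), 1, ϖ])
    (hfin₀₁ : (fixedBy (↥(unitaryGroupOfForm σ ((StdForm.antidiagonal 3).over K)) ⧸
      (glInt 3 K).subgroupOf (unitaryGroupOfForm σ ((StdForm.antidiagonal 3).over K))) γ₁).Finite)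
    (hfin₁₁ : (fixedBy (↥(unitaryGroupOfForm σ ((StdForm.antidiagonal 3).over K)) ⧸
      ((glInt 3 K).map (MulAut.conj g₁).toMonoidHom).subgroupOf (unitaryGroupOfForm σ ((StdForm.antidiagonal 3).over K))) γ₁).Finite)
    (hfin₀₂ : (fixedBy (↥(unitaryGroupOfForm σ ((StdForm.antidiagonal 3).over K)) ⧸
      (glInt 3 K).subgroupOf (unitaryGroupOfForm σ ((StdForm.antidiagonal 3).over K))) γ₂).Finite)
    (hfin₁₂ : (fixedBy (↥(unitaryGroupOfForm σ ((StdForm.antidiagonal 3).over K)) ⧸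
      ((glInt 3 K).map (MulAut.conj g₁).toMonoidHom).subgroupOf (unitaryGroupOfForm σ ((StdForm.antidiagonal 3).over K))) γ₂).Finite)
    (hfin₀₃ : (fixedBy (↥(unitaryGroupOfForm σ ((StdForm.antidiagonal 3).over K)) ⧸
      (glInt 3 K).subgroupOf (unitaryGroupOfForm σ ((StdForm.antidiagonal 3).over K))) γ₃).Finite)
    (hfin₁₃ : (fixedBy (↥(unitaryGroupOfForm σ ((StdForm.antidiagonal 3).over K)) ⧸
      ((glInt 3 K).map (MulAut.conj g₁).toMonoidHom).subgroupOf (unitaryGroupOfForm σ ((StdForm.antidiagonal 3).over K))) γ₃).Finite)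
    (hfin₀₄ : (fixedBy (↥(unitaryGroupOfForm σ ((StdForm.antidiagonal 3).over K)) ⧸
      (glInt 3 K).subgroupOf (unitaryGroupOfForm σ ((StdForm.antidiagonal 3).over K))) γ₄).Finite)
    (hfin₁₄ : (fixedBy (↥(unitaryGroupOfForm σ ((StdForm.antidiagonal 3).over K)) ⧸
      ((glInt 3 K).map (MulAut.conj g₁).toMonoidHom).subgroupOf (unitaryGroupOfForm σ ((StdForm.antidiagonal 3).over K))) γ₄).Finite)
    (x₀ : {M : Submodule (ValuativeRel.valuation K).integer (Fin 2 → K) // HermitianLatticeTree.IsSpecialLattice σ ϖ ((StdForm.antidiagonal 2).over K) M})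
    (hx₀ : x₀.1 = HermitianLatticeTree.latt (1 : Matrix (Fin 2) (Fin 2) K))
    (hloc : ∀ v, ((HermitianLatticeTree.latticeTree σ ϖ ((StdForm.antidiagonal 2).over K)).neighborSet v).Finite)
    (hreg : ∀ v, ((HermitianLatticeTree.latticeTree σ ϖ ((StdForm.antidiagonal 2).over K)).neighborSet v).ncard = q + 1)
    -- (U1): the special-level unit identity
    (hU1 : (-(q : ℂ)) ^ WithZero.log (Valued.v ((b - a) * (b - c))) *
        ((Nat.card (fixedBy (↥(unitaryGroupOfForm σ ((StdForm.antidiagonal 3).over K)) ⧸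
            ((glInt 3 K).map (MulAut.conj g₁).toMonoidHom).subgroupOf (unitaryGroupOfForm σ ((StdForm.antidiagonal 3).over K))) γ₁) : ℂ) +
          (Nat.card (fixedBy (↥(unitaryGroupOfForm σ ((StdForm.antidiagonal 3).over K)) ⧸
            ((glInt 3 K).map (MulAut.conj g₁).toMonoidHom).subgroupOf (unitaryGroupOfForm σ ((StdForm.antidiagonal 3).over K))) γ₂) : ℂ) -
          (Nat.card (fixedBy (↥(unitaryGroupOfForm σ ((StdForm.antidiagonal 3).over K)) ⧸
            ((glInt 3 K).map (MulAut.conj g₁).toMonoidHom).subgroupOf (unitaryGroupOfForm σ ((StdForm.antidiagonal 3).over K))) γ₃) : ℂ) -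
          (Nat.card (fixedBy (↥(unitaryGroupOfForm σ ((StdForm.antidiagonal 3).over K)) ⧸
            ((glInt 3 K).map (MulAut.conj g₁).toMonoidHom).subgroupOf (unitaryGroupOfForm σ ((StdForm.antidiagonal 3).over K))) γ₄) : ℂ)) =
      (({v | HermitianLatticeTree.latticeTreeIso σ ϖ ((StdForm.antidiagonal 2).over K) δ₁ v = v}.ncard : ℕ) : ℂ) - 2)
    (m : ℕ) :
    (-(q : ℂ)) ^ WithZero.log (Valued.v ((b - a) * (b - c))) *
        (({x : {M : Submodule 𝒪[K] (Fin 3 → K) // UnitaryLatticeTree.IsVertex σ ϖ ((StdForm.antidiagonal 3).over K) M} |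
              UnitaryLatticeTree.IsSelfDualLattice σ ϖ ((StdForm.antidiagonal 3).over K) x.1 ∧
                (UnitaryLatticeTree.latticeGraph σ ϖ ((StdForm.antidiagonal 3).over K)).dist x
                  (UnitaryLatticeTree.latticeGraphPerm σ ϖ ((StdForm.antidiagonal 3).over K) γ₁ x) = 2 * m}.ncard : ℂ) +
          ({x : {M : Submodule 𝒪[K] (Fin 3 → K) // UnitaryLatticeTree.IsVertex σ ϖ ((StdForm.antidiagonal 3).over K) M} |
              UnitaryLatticeTree.IsSelfDualLattice σ ϖ ((StdForm.antidiagonal 3).over K) x.1 ∧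
                (UnitaryLatticeTree.latticeGraph σ ϖ ((StdForm.antidiagonal 3).over K)).dist x
                  (UnitaryLatticeTree.latticeGraphPerm σ ϖ ((StdForm.antidiagonal 3).over K) γ₂ x) = 2 * m}.ncard : ℂ) -
          ({x : {M : Submodule 𝒪[K] (Fin 3 → K) // UnitaryLatticeTree.IsVertex σ ϖ ((StdForm.antidiagonal 3).over K) M} |
              UnitaryLatticeTree.IsSelfDualLattice σ ϖ ((StdForm.antidiagonal 3).over K) x.1 ∧
                (UnitaryLatticeTree.latticeGraph σ ϖ ((StdForm.antidiagonal 3).over K)).dist x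
                  (UnitaryLatticeTree.latticeGraphPerm σ ϖ ((StdForm.antidiagonal 3).over K) γ₃ x) = 2 * m}.ncard : ℂ) -
          ({x : {M : Submodule 𝒪[K] (Fin 3 → K) // UnitaryLatticeTree.IsVertex σ ϖ ((StdForm.antidiagonal 3).over K) M} |
              UnitaryLatticeTree.IsSelfDualLattice σ ϖ ((StdForm.antidiagonal 3).over K) x.1 ∧
                (UnitaryLatticeTree.latticeGraph σ ϖ ((StdForm.antidiagonal 3).over K)).dist x
                  (UnitaryLatticeTree.latticeGraphPerm σ ϖ ((StdForm.antidiagonal 3).over K) γ₄ x) = 2 * m}.ncard : ℂ)) =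
      (∑ k ∈ Finset.range (m + 1), xiHCoeff q m k *
          ({x : {M : Submodule (ValuativeRel.valuation K).integer (Fin 2 → K) // HermitianLatticeTree.IsSpecialLattice σ ϖ ((StdForm.antidiagonal 2).over K) M} |
              HermitianLatticeTree.IsSelfDualLattice σ ((StdForm.antidiagonal 2).over K) x.1 ∧
                (HermitianLatticeTree.latticeTree σ ϖ ((StdForm.antidiagonal 2).over K)).dist x
                  (HermitianLatticeTree.latticeTreeIso σ ϖ ((StdForm.antidiagonal 2).over K) δ₁ x) = 2 * k}.ncard : ℂ)) +
        ∑ k ∈ Finset.range (m + 1), xiHCoeff q m k *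
          ({x : {M : Submodule (ValuativeRel.valuation K).integer (Fin 2 → K) // HermitianLatticeTree.IsSpecialLattice σ ϖ ((StdForm.antidiagonal 2).over K) M} |
              HermitianLatticeTree.IsSelfDualLattice σ ((StdForm.antidiagonal 2).over K) x.1 ∧
                (HermitianLatticeTree.latticeTree σ ϖ ((StdForm.antidiagonal 2).over K)).dist x
                  (HermitianLatticeTree.latticeTreeIso σ ϖ ((StdForm.antidiagonal 2).over K) δ₂ x) = 2 * k}.ncard : ℂ) := by
  exact delta_mul_kappaSum_ncard_displaced_flicker_eq_sum_xiHCoeff_mul_ncard_displaced_two_of_unitLevels hd hσO σk hσk hq hfrob h2 h2e ha hb hc hac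
    γ₁ γ₂ γ₃ γ₄ hγ₁ hγ₂ hγ₃ hγ₄ δ₁ δ₂ hδ₁ hδ₂ g₁ hg₁ hfin₀₁ hfin₁₁ hfin₀₂ hfin₁₂ hfin₀₃ hfin₁₃ hfin₀₄ hfin₁₄ x₀ hx₀ hloc hreg
    (delta_mul_kappaSum_natCard_fixedBy_flicker_eq_ncard_fixed hd hσO hq h2 h2e ha hb hc hab hbc hac γ₁ γ₂ γ₃ γ₄ hγ₁ hγ₂ hγ₃ hγ₄ δ₁ hδ₁
      hy hcW um hum ι hι hιv σR hσR hσι hdRσ hdRu h2R hϖR hιϖ hqR ha₀ hfin₀₁ hfin₀₂ hfin₀₃ hfin₀₄ x₀ hx₀ hloc hreg)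
    hU1 m

end UnitLevel

end Summit.HodgeConjecture.HodgeConjecture.R90.S6

end
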